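import Summits.RiemannHypothesis.RiemannHypothesis.Theorems.WeilBochnerMeasureCountingPrelim
import Summits.RiemannHypothesis.RiemannHypothesis.Theorems.WeilBochnerMeasureZeroFreeKernel
import Literature.NumberTheory.LFunctions.WeilGroundEnergyProofs
import Mathlib.MeasureTheory.Integral.Bochner.ContinuousLinearMap
import HarnessLib

/-!
# RiemannHypothesis — the Bochner–Kreĭn measure IS the spectral side of the explicit formula on the window

Helper file (`--supports stmt-RiemannHypothesis-0098`), RH-free, standard axioms.  Seat rh-explicit
weil-3 (structure).

Let `μ` represent Weil's form on the window `[-b, b]`, `b > 0` (hypothesis `hμ`: for every smooth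
test `g` supported in `[-b, b]`, `‖ĝ(½+it)‖² ∈ L¹(μ)` and `W(g ⋆ g̃) = ∫ ‖ĝ(½+it)‖² dμ` — the
conclusion of `Literature.NumberTheory.LFunctions.WeilBochner.exists_measure_of_weilPositivityOn`).
So far `μ` was known to reproduce `W` on hermitian SQUARES and (previous files) on continuous kernels
with NONNEGATIVE transform.  Here:

* **`integral_weilMellin_eq_weilFunctional`**: for EVERY smooth test `k` with `tsupport k ⊆ [-a, a]`,
  `a < 2b`: `k̂(½+i·) ∈ L¹(μ)` and **`∫ k̂(½+it) dμ(t) = W(k)`** — the measure is the Fourier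
  transform of Weil's distribution on the open window `(-2b, 2b)`: it reproduces the full explicit
  formula (polar term − prime sum + archimedean term) of every observable of prime-side support `< 2b`,
  not only of autocorrelations;
* `weilFunctional_eq_integral_of_im_eq_zero`: the hermitian case (real transform);
* `integral_weilMellin_eq_integral_weilMellin` (**determinacy**): two measures representing Weil's form
  on windows `b₁, b₂` have the same integral against `k̂` for every test `k` of support `< 2 min b₁ b₂`
  — they differ by a measure whose Fourier transform vanishes on that window (so, by the counting law,
  only in where mass sits at scale `≳ 1/b`, never in how much).

Proof of the hermitian case: the zero-free kernel `κ` of `WeilBochnerMeasureZeroFreeKernel.lean`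
(`κ̂(½+iu) ≥ r/(1+u²)²`, support `[-2r, 2r]`, `2r ≤ b`) dominates `|k̂| ≤ D/(1+u²)²`
(`exists_norm_weilMellin_le_sq`), so `k + (D/r) κ` and `(D/r) κ` are continuous kernels with
nonnegative transforms, to which `weilFunctional_kernel_eq_integral` applies; subtract
(`weilFunctional_add_of_continuous`).  General case: `k = ½(k + k̃) + i · (−i/2)(k − k̃)`, both parts
hermitian with transforms `Re k̂`, `Im k̂`.
-/

noncomputable section

set_option linter.dupNamespace false  -- the mandated namespace repeats `RiemannHypothesis`

open Complex Filter Set MeasureTheory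
open scoped Real Topology ComplexConjugate
open Literature.NumberTheory.LFunctions

namespace Summit.RiemannHypothesis.RiemannHypothesis.Theorems.WeilBochnerMeasure

variable {b : ℝ} {μ : Measure ℝ}

/-! ## Quartic decay of the transform of a smooth test -/

/-- `‖k̂(½+iu)‖ ≤ D/(1+u²)²` for a smooth compactly supported `k` (two and four integrations by parts:
`norm_weilMellin_le` for `k` and for `k″`, `(k″)^(s) = (s − ½)² k̂(s)`). -/
theorem exists_norm_weilMellin_le_sq {k : ℝ → ℂ} (hk : IsWeilTest k) :
    ∃ D : ℝ, 0 ≤ D ∧ ∀ u : ℝ, ‖weilMellin k (1 / 2 + u * I)‖ ≤ D / (1 + u ^ 2) ^ 2 := by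
  set D₁ := weilDecayConst k
  set D₂ := weilDecayConst (deriv (deriv k))
  have hre : ∀ u : ℝ, ((1 : ℂ) / 2 + u * I).re = 1 / 2 := fun u ↦ by simp
  have him : ∀ u : ℝ, ((1 : ℂ) / 2 + u * I).im = u := fun u ↦ by simp
  have h1 : ∀ u : ℝ, ‖weilMellin k (1 / 2 + u * I)‖ ≤ D₁ / (1 + u ^ 2) := fun u ↦ by
    have h := norm_weilMellin_le hk (s := 1 / 2 + u * I) (by rw [hre]; norm_num) (by rw [hre]; norm_num)
    rwa [him] at h
  have h2 : ∀ u : ℝ, u ^ 2 * ‖weilMellin k (1 / 2 + u * I)‖ ≤ D₂ / (1 + u ^ 2) := fun u ↦ by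
    have h := norm_weilMellin_le hk.deriv.deriv (s := 1 / 2 + u * I) (by rw [hre]; norm_num)
      (by rw [hre]; norm_num)
    rw [him, weilMellin_deriv_deriv hk, norm_mul] at h
    have e : ‖((1 : ℂ) / 2 + u * I - 1 / 2) ^ 2‖ = u ^ 2 := by
      rw [show (1 : ℂ) / 2 + u * I - 1 / 2 = u * I by ring, norm_pow, norm_mul, Complex.norm_real,
        Complex.norm_I, mul_one, Real.norm_eq_abs, sq_abs]
    rwa [e] at h
  have hD₁ : 0 ≤ D₁ := by
    have h := (norm_nonneg _).trans (h1 0)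
    simpa using h
  have hD₂ : 0 ≤ D₂ := by
    have h := h2 1
    have h0 : 0 ≤ (1 : ℝ) ^ 2 * ‖weilMellin k (1 / 2 + (1 : ℝ) * I)‖ := by positivity
    have h3 : 0 ≤ D₂ / (1 + (1 : ℝ) ^ 2) := h0.trans h
    have hpos : (0 : ℝ) < 1 + (1 : ℝ) ^ 2 := by norm_num
    by_contra hneg
    rw [not_le] at hneg
    have : D₂ / (1 + (1 : ℝ) ^ 2) < 0 := div_neg_of_neg_of_pos hneg hpos
    linarith
  refine ⟨D₁ + D₂, by positivity, fun u ↦ ?_⟩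
  have hpos : 0 < 1 + u ^ 2 := by positivity
  have key : (1 + u ^ 2) * ‖weilMellin k (1 / 2 + u * I)‖ ≤ (D₁ + D₂) / (1 + u ^ 2) := by
    rw [add_div]
    have := add_le_add (h1 u) (h2 u)
    linarith
  rw [le_div_iff₀ (by positivity)]
  rw [le_div_iff₀ hpos] at key
  nlinarith [key]

/-! ## The hermitian case: tests with real transform -/

/-- **Tests with real transform.**  If `μ` represents Weil's form on `[-b, b]` (`b > 0`) and `k` is a
smooth test supported in `[-a, a]`, `a < 2b`, whose transform is real on the critical line, then
`Re k̂(½+i·) ∈ L¹(μ)` and `W(k) = ∫ Re k̂(½+it) dμ(t)` (add a multiple of the zero-free kernel to make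
the transform nonnegative, apply `weilFunctional_kernel_eq_integral`, subtract). -/
theorem weilFunctional_eq_integral_of_im_eq_zero (hb : 0 < b)
    (hμ : ∀ g : ℝ → ℂ, IsWeilTest g → tsupport g ⊆ Icc (-b) b →
      Integrable (fun t : ℝ ↦ ‖weilMellin g (1 / 2 + t * I)‖ ^ 2) μ ∧
        weilQuadratic g = ((∫ t, ‖weilMellin g (1 / 2 + t * I)‖ ^ 2 ∂μ : ℝ) : ℂ))
    {k : ℝ → ℂ} (hk : IsWeilTest k) {a : ℝ} (ha : a < 2 * b) (hkt : tsupport k ⊆ Icc (-a) a)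
    (hreal : ∀ u : ℝ, (weilMellin k (1 / 2 + u * I)).im = 0) :
    Integrable (fun t : ℝ ↦ (weilMellin k (1 / 2 + t * I)).re) μ ∧
      weilFunctional k = ((∫ t, (weilMellin k (1 / 2 + t * I)).re ∂μ : ℝ) : ℂ) := by
  -- the zero-free kernel of radius `r = min 1 (b/2)`
  set r : ℝ := min 1 (b / 2) with hr
  have hr0 : 0 < r := lt_min one_pos (by linarith)
  have hr1 : r ≤ 1 := min_le_left _ _
  have hrb : 2 * r ≤ b := by have := min_le_right 1 (b / 2); linarith
  obtain ⟨κ, hκc, hκs, hκ⟩ := exists_zeroFree_kernel hr0 hr1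
  have hκcs : HasCompactSupport κ := isCompact_Icc.of_isClosed_subset (isClosed_tsupport _) hκs
  obtain ⟨D, hD0, hD⟩ := exists_norm_weilMellin_le_sq hk
  set c : ℝ := D / r with hc
  have hc0 : 0 ≤ c := div_nonneg hD0 hr0.le
  -- the two kernels `κc = c κ` and `kk = k + c κ`
  set κc : ℝ → ℂ := fun x ↦ (c : ℂ) * κ x with hκcdef
  have hκcc : Continuous κc := continuous_const.mul hκc
  set a' : ℝ := max a (2 * r) with ha'
  have ha'b : a' < 2 * b := max_lt ha (by linarith)
  have hκct : tsupport κc ⊆ Icc (-a') a' := by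
    refine (closure_minimal (fun x hx ↦ ?_) (isClosed_tsupport κ)).trans
      (hκs.trans (Icc_subset_Icc (by simp [ha']) (le_max_right _ _)))
    rw [Function.mem_support] at hx
    exact subset_tsupport _ (Function.mem_support.2 fun h ↦ hx (by simp [hκcdef, h]))
  have hκccs : HasCompactSupport κc := isCompact_Icc.of_isClosed_subset (isClosed_tsupport _) hκct
  have hkt' : tsupport k ⊆ Icc (-a') a' := hkt.trans (Icc_subset_Icc (by simp [ha']) (le_max_left _ _))
  have hkkt : tsupport (k + κc) ⊆ Icc (-a') a' := (tsupport_add _ _).trans (union_subset hkt' hκct)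
  have hkkc : Continuous (k + κc) := hk.1.continuous.add hκcc
  -- transforms on the line
  have hκc_line : ∀ u : ℝ, weilMellin κc (1 / 2 + u * I) = (c : ℂ) * weilMellin κ (1 / 2 + u * I) :=
    fun u ↦ weilMellin_const_mul _ _ _
  have hkk_line : ∀ u : ℝ, weilMellin (k + κc) (1 / 2 + u * I) =
      weilMellin k (1 / 2 + u * I) + (c : ℂ) * weilMellin κ (1 / 2 + u * I) := fun u ↦ by
    rw [weilMellin_add hk.1.continuous hk.2 hκcc hκccs, hκc_line]
  -- decay and sign of `κc`
  have hκc_dec : ∀ u : ℝ, ‖weilMellin κc (1 / 2 + u * I)‖ ≤ (36 * c / r) / (1 + u ^ 2) := fun u ↦ by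
    rw [hκc_line, norm_mul, Complex.norm_real, Real.norm_eq_abs, abs_of_nonneg hc0]
    calc c * ‖weilMellin κ (1 / 2 + u * I)‖ ≤ c * (36 / (r * (1 + u ^ 2))) :=
          mul_le_mul_of_nonneg_left (hκ u).2.2 hc0
      _ = 36 * c / r / (1 + u ^ 2) := by
          field_simp
  have hκc_pos : ∀ u : ℝ, (weilMellin κc (1 / 2 + u * I)).im = 0 ∧
      0 ≤ (weilMellin κc (1 / 2 + u * I)).re := fun u ↦ by
    rw [hκc_line, Complex.re_ofReal_mul, Complex.im_ofReal_mul, (hκ u).1, mul_zero]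
    exact ⟨rfl, mul_nonneg hc0 (le_trans (by positivity) (hκ u).2.1)⟩
  -- decay and sign of `kk`
  have hkk_dec : ∀ u : ℝ, ‖weilMellin (k + κc) (1 / 2 + u * I)‖ ≤ (D + 36 * c / r) / (1 + u ^ 2) :=
    fun u ↦ by
      rw [hkk_line, ← hκc_line]
      refine (norm_add_le _ _).trans ?_
      rw [add_div]
      refine add_le_add ((hD u).trans ?_) (hκc_dec u)
      rw [div_le_div_iff₀ (by positivity) (by positivity)]
      have : 1 + u ^ 2 ≤ (1 + u ^ 2) ^ 2 := by nlinarith [sq_nonneg u]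
      nlinarith
  have hkk_pos : ∀ u : ℝ, (weilMellin (k + κc) (1 / 2 + u * I)).im = 0 ∧
      0 ≤ (weilMellin (k + κc) (1 / 2 + u * I)).re := fun u ↦ by
    rw [hkk_line, Complex.add_im, Complex.add_re, Complex.re_ofReal_mul, Complex.im_ofReal_mul,
      (hκ u).1, hreal u, mul_zero, add_zero]
    refine ⟨rfl, ?_⟩
    have h1 : -(D / (1 + u ^ 2) ^ 2) ≤ (weilMellin k (1 / 2 + u * I)).re := by
      have := (abs_le.1 ((Complex.abs_re_le_norm _).trans (hD u))).1
      linarith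
    have h2 : D / (1 + u ^ 2) ^ 2 ≤ c * (weilMellin κ (1 / 2 + u * I)).re := by
      calc D / (1 + u ^ 2) ^ 2 = c * (r / (1 + u ^ 2) ^ 2) := by
            rw [hc]; field_simp
        _ ≤ c * (weilMellin κ (1 / 2 + u * I)).re := mul_le_mul_of_nonneg_left (hκ u).2.1 hc0
    linarith
  -- the kernel lemma, twice
  obtain ⟨hIkk, hWkk⟩ := weilFunctional_kernel_eq_integral hb hμ hkkc ha'b hkkt hkk_dec hkk_pos
  obtain ⟨hIκc, hWκc⟩ := weilFunctional_kernel_eq_integral hb hμ hκcc ha'b hκct hκc_dec hκc_pos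
  simp only [hkk_line, Complex.add_re, Complex.re_ofReal_mul] at hIkk hWkk
  simp only [hκc_line, Complex.re_ofReal_mul] at hIκc hWκc
  -- additivity and subtraction
  have hAk : Integrable (fun t : ℝ ↦
      weilMellin k (1 / 2 + t * I) * ((Complex.digamma (1 / 4 + t / 2 * I)).re : ℂ)) :=
    integrable_arch_of_decay hk.1.continuous hk.2 (M := D) fun u ↦ (hD u).trans (by
      rw [div_le_div_iff₀ (by positivity) (by positivity)]
      have : 1 + u ^ 2 ≤ (1 + u ^ 2) ^ 2 := by nlinarith [sq_nonneg u]
      nlinarith)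
  have hAκc := integrable_arch_of_decay hκcc hκccs hκc_dec
  have hadd := weilFunctional_add_of_continuous hk.1.continuous hk.2 hκcc hκccs hAk hAκc
  have hIk : Integrable (fun t : ℝ ↦ (weilMellin k (1 / 2 + t * I)).re) μ :=
    (hIkk.sub hIκc).congr (ae_of_all _ fun t ↦ by simp only [Pi.sub_apply]; ring)
  refine ⟨hIk, ?_⟩
  have hW : weilFunctional k = weilFunctional (k + κc) - weilFunctional κc := by rw [hadd]; ring
  rw [hW, hWkk, hWκc, ← Complex.ofReal_sub, ← integral_sub hIkk hIκc]
  congr 1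
  exact integral_congr_ae (ae_of_all _ fun t ↦ by ring)

/-! ## The general case -/

/-- **The representing measure reproduces the explicit formula on every test of the open window.**
If `μ` represents Weil's form on `[-b, b]` (`b > 0`) then for every smooth test `k` with
`tsupport k ⊆ [-a, a]`, `a < 2b`: `k̂(½+i·) ∈ L¹(μ)` and `∫ k̂(½+it) dμ(t) = W(k)` — `μ` is the
Fourier transform of Weil's explicit-formula distribution on `(-2b, 2b)`.  (Hermitian and
anti-hermitian parts `½(k + k̃)`, `(−i/2)(k − k̃)` have real transforms `Re k̂`, `Im k̂`.) -/
theorem integral_weilMellin_eq_weilFunctional (hb : 0 < b)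
    (hμ : ∀ g : ℝ → ℂ, IsWeilTest g → tsupport g ⊆ Icc (-b) b →
      Integrable (fun t : ℝ ↦ ‖weilMellin g (1 / 2 + t * I)‖ ^ 2) μ ∧
        weilQuadratic g = ((∫ t, ‖weilMellin g (1 / 2 + t * I)‖ ^ 2 ∂μ : ℝ) : ℂ))
    {k : ℝ → ℂ} (hk : IsWeilTest k) {a : ℝ} (ha : a < 2 * b) (hkt : tsupport k ⊆ Icc (-a) a) :
    Integrable (fun t : ℝ ↦ weilMellin k (1 / 2 + t * I)) μ ∧
      ∫ t, weilMellin k (1 / 2 + t * I) ∂μ = weilFunctional k := by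
  -- the reflected test and the two hermitian parts
  have hkr : IsWeilTest (weilReflect k) := hk.weilReflect
  have hkrt : tsupport (weilReflect k) ⊆ Icc (-a) a := by
    rw [tsupport_weilReflect]
    intro x hx
    have h := hkt (show -x ∈ tsupport k by simpa using hx)
    simp only [mem_Icc] at h ⊢
    constructor <;> linarith [h.1, h.2]
  set k₁ : ℝ → ℂ := fun x ↦ (1 / 2 : ℂ) * (k + weilReflect k) x with hk₁
  set k₂ : ℝ → ℂ := fun x ↦ (-(I / 2)) * (k + fun y ↦ (-1 : ℂ) * weilReflect k y) x with hk₂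
  have hk₁t : IsWeilTest k₁ := (hk.add hkr).const_mul _
  have hkr' : IsWeilTest (fun y ↦ (-1 : ℂ) * weilReflect k y) := hkr.const_mul _
  have hk₂t : IsWeilTest k₂ := (hk.add hkr').const_mul _
  -- supports
  have hsum₁ : tsupport (k + weilReflect k) ⊆ Icc (-a) a := (tsupport_add _ _).trans (union_subset hkt hkrt)
  have hkr't : tsupport (fun y ↦ (-1 : ℂ) * weilReflect k y) ⊆ Icc (-a) a :=
    (tsupport_mul_subset_right (f := fun _ : ℝ ↦ (-1 : ℂ)) (g := weilReflect k)).trans hkrt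
  have hsum₂ : tsupport (k + fun y ↦ (-1 : ℂ) * weilReflect k y) ⊆ Icc (-a) a :=
    (tsupport_add _ _).trans (union_subset hkt hkr't)
  have hk₁s : tsupport k₁ ⊆ Icc (-a) a :=
    (tsupport_mul_subset_right (f := fun _ : ℝ ↦ (1 / 2 : ℂ)) (g := k + weilReflect k)).trans hsum₁
  have hk₂s : tsupport k₂ ⊆ Icc (-a) a :=
    (tsupport_mul_subset_right (f := fun _ : ℝ ↦ -(I / 2))
      (g := k + fun y ↦ (-1 : ℂ) * weilReflect k y)).trans hsum₂
  -- transforms on the line: `k̂₁ = Re k̂`, `k̂₂ = Im k̂`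
  have hline₁ : ∀ u : ℝ, weilMellin k₁ (1 / 2 + u * I) = ((weilMellin k (1 / 2 + u * I)).re : ℂ) := by
    intro u
    simp only [hk₁]
    rw [weilMellin_const_mul, weilMellin_add hk.1.continuous hk.2 hkr.1.continuous hkr.2,
      WeilBochner.weilMellin_weilReflect_half, Complex.add_conj]
    push_cast; ring
  have hline₂ : ∀ u : ℝ, weilMellin k₂ (1 / 2 + u * I) = ((weilMellin k (1 / 2 + u * I)).im : ℂ) := by
    intro u
    simp only [hk₂]
    rw [weilMellin_const_mul, weilMellin_add hk.1.continuous hk.2 hkr'.1.continuous hkr'.2,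
      weilMellin_const_mul, WeilBochner.weilMellin_weilReflect_half]
    apply Complex.ext
    · simp; ring
    · simp
  -- the hermitian case for both parts
  obtain ⟨hI₁, hW₁⟩ := weilFunctional_eq_integral_of_im_eq_zero hb hμ hk₁t ha hk₁s
    (fun u ↦ by rw [hline₁, Complex.ofReal_im])
  obtain ⟨hI₂, hW₂⟩ := weilFunctional_eq_integral_of_im_eq_zero hb hμ hk₂t ha hk₂s
    (fun u ↦ by rw [hline₂, Complex.ofReal_im])
  simp only [hline₁, hline₂, Complex.ofReal_re] at hI₁ hW₁ hI₂ hW₂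
  -- `k = k₁ + i k₂`
  have hdecomp : k = k₁ + fun x ↦ I * k₂ x := by
    funext x
    simp only [hk₁, hk₂, Pi.add_apply]
    ring_nf
    rw [Complex.I_sq]
    ring
  have hWk : weilFunctional k = weilFunctional k₁ + I * weilFunctional k₂ := by
    conv_lhs => rw [hdecomp]
    rw [weilFunctional_add hk₁t (hk₂t.const_mul I), weilFunctional_const_mul I k₂]
  -- integrability and the integral of `k̂ = Re k̂ + i Im k̂`
  have hptw : ∀ t : ℝ, weilMellin k (1 / 2 + t * I) =
      ((weilMellin k (1 / 2 + t * I)).re : ℂ) + I * ((weilMellin k (1 / 2 + t * I)).im : ℂ) := fun t ↦ by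
    rw [mul_comm I]; exact (Complex.re_add_im _).symm
  have hI₁' : Integrable (fun t : ℝ ↦ ((weilMellin k (1 / 2 + t * I)).re : ℂ)) μ := hI₁.ofReal
  have hI₂' : Integrable (fun t : ℝ ↦ ((weilMellin k (1 / 2 + t * I)).im : ℂ)) μ := hI₂.ofReal
  have hI₂'' : Integrable (fun t : ℝ ↦ I * ((weilMellin k (1 / 2 + t * I)).im : ℂ)) μ :=
    hI₂'.const_mul I
  have hInt : Integrable (fun t : ℝ ↦ weilMellin k (1 / 2 + t * I)) μ := by
    refine (hI₁'.add hI₂'').congr (ae_of_all _ fun t ↦ ?_)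
    simp only [Pi.add_apply]
    exact (hptw t).symm
  refine ⟨hInt, ?_⟩
  rw [hWk, hW₁, hW₂, integral_congr_ae (ae_of_all _ hptw), integral_add hI₁' hI₂'',
    integral_const_mul, integral_complex_ofReal, integral_complex_ofReal]

/-- **Determinacy of the spectral side.**  Two measures representing Weil's form on windows `b₁, b₂`
integrate every test transform of prime-side support `< 2 min b₁ b₂` identically (both equal `W(k)`):
their difference is a (signed) measure whose Fourier transform vanishes on that window. -/
theorem integral_weilMellin_eq_integral_weilMellin {b₁ b₂ : ℝ} {μ₁ μ₂ : Measure ℝ}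
    (hb₁ : 0 < b₁) (hb₂ : 0 < b₂)
    (hμ₁ : ∀ g : ℝ → ℂ, IsWeilTest g → tsupport g ⊆ Icc (-b₁) b₁ →
      Integrable (fun t : ℝ ↦ ‖weilMellin g (1 / 2 + t * I)‖ ^ 2) μ₁ ∧
        weilQuadratic g = ((∫ t, ‖weilMellin g (1 / 2 + t * I)‖ ^ 2 ∂μ₁ : ℝ) : ℂ))
    (hμ₂ : ∀ g : ℝ → ℂ, IsWeilTest g → tsupport g ⊆ Icc (-b₂) b₂ →
      Integrable (fun t : ℝ ↦ ‖weilMellin g (1 / 2 + t * I)‖ ^ 2) μ₂ ∧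
        weilQuadratic g = ((∫ t, ‖weilMellin g (1 / 2 + t * I)‖ ^ 2 ∂μ₂ : ℝ) : ℂ))
    {k : ℝ → ℂ} (hk : IsWeilTest k) {a : ℝ} (ha : a < 2 * min b₁ b₂)
    (hkt : tsupport k ⊆ Icc (-a) a) :
    ∫ t, weilMellin k (1 / 2 + t * I) ∂μ₁ = ∫ t, weilMellin k (1 / 2 + t * I) ∂μ₂ := by
  have ha₁ : a < 2 * b₁ := lt_of_lt_of_le ha (by linarith [min_le_left b₁ b₂])
  have ha₂ : a < 2 * b₂ := lt_of_lt_of_le ha (by linarith [min_le_right b₁ b₂])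
  rw [(integral_weilMellin_eq_weilFunctional hb₁ hμ₁ hk ha₁ hkt).2,
    (integral_weilMellin_eq_weilFunctional hb₂ hμ₂ hk ha₂ hkt).2]

end Summit.RiemannHypothesis.RiemannHypothesis.Theorems.WeilBochnerMeasure

end
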